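import Summits.BirchSwinnertonDyer.Rank1Residual.F1Sign2.MarkedTwoSelmerLawAtTwo
import HarnessLib

/-!
# Cell `bsd-f1-sign2` — kernel glue for `F1Sign2/MarkedTwoSelmerLawAtTwo.lean` (file 2 of 2 of the MEMO-an v1.62 §24.12/§24.14/§24.15 port)

THEOREMS ONLY (no `def`, no `sorry`, no named fact, no instance; ns `…F1Sign2.ANg21` as file 1).  Contents: -an g21's three glue theorems from
`Sketch_v62.lean` b77f8f722526f6c1 VERBATIM — `rootNumberInvariant_of_rootNumberLaw` (S38k ⟸ S38h♮ + `hfin`, l.627–635), `quadraticRayClassCharactersArch_empty`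
(`S = ∅` recovers the finite carrier, l.693–698), `shaTwoDecider_of_grandUnifiedLaw` (S38q ⟸ S38n, l.772–775) — and REF1 §180's sorry-free certificates from
`HOME/REF1-data/b180/lean/Probe180.lean` 5539310bf254b81b VERBATIM (ns `REF1g16e` → `ANg21`): `oddTamagawaPosDiscIffSameK_of_S38j` (the sameK dictionary ⟸ S38j),
`rootNumberInvariant_of_selmerLaws` (S38k ⟸ S38f♮ ∧ S38h♮ ∧ «`#Sel₂` is a power of 2»), `rootNumberLawPos_of_selmerLawPos` (S38m ⟸ S38l + DD parity),
`quadraticRayClassCharactersArch_top` (junk at `𝔪 = ⊤`), `markedCount_symm` (S38l symmetric in `σ₂, σ₃`), `marked_iff_coMarked : L180 → (S38l ↔ S38l′)`,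
`markedRoot_iff_coMarkedRoot : L180 → (S38m ↔ S38m′)`, `coMarkedRoot_of_coMarked` (S38m′ ⟸ S38l′ + DD), `shaTwoDecider_without_analyticRank` (S38q is S38n rewritten);
plus the typer's two support lemmas for REF1 duty (1): `exists_natCard_selmerGroup_two_eq_pow` («`#Sel₂(E/ℚ) = 2^k` for some `k`», from the tree's
`Literature.NumberTheory.EllipticCurves.exists_natCard_selmerGroup_eq_pow`) and `rootNumberIsInvariantOfTwoDivisionField_of_selmerLaws` (S38k ⟸ S38f♮ ∧ S38h♮ with
`hpow` discharged).  Typer -ty g16; std axioms checked on the combined scratch.  BSD is not proved by this; no item closed.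
-/

namespace Summit.BirchSwinnertonDyer.Rank1Residual.F1Sign2.ANg21

open Literature.NumberTheory.EllipticCurves Literature.NumberTheory.EllipticCurves.ModularForms UpperHalfPlane
open Literature.NumberTheory.EllipticCurves.Rank1Residual
open Summit.BirchSwinnertonDyer.Rank1Residual.F1Sign2 Summit.BirchSwinnertonDyer.Rank1Residual.F1Sign2.ANg17
open Summit.BirchSwinnertonDyer.Rank1Residual.F1Sign2.ANg18 Summit.BirchSwinnertonDyer.Rank1Residual.F1Sign2.ANg19
open Summit.BirchSwinnertonDyer.Rank1Residual.F1Sign2.ANg20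
open scoped Classical

section Dictionary
open NumberField

/-- Sanity glue: S38k follows from S38h♮ once the quadratic ray-class character set is known to be finite of `2`-power order
(true: it is `Hom(Cl_{𝔮²}(F), ±1)`; not yet a tree fact, so taken as the hypothesis `hfin`). -/
theorem rootNumberInvariant_of_rootNumberLaw (h : RootNumberFromCubicRayClassOddTamagawa)
    (hfin : ∀ (F : Type) [Field F] [NumberField F] (m : Ideal (𝓞 F)), ∃ k : ℕ, Nat.card (quadraticRayClassCharacters F m) = 2 ^ k) :
    RootNumberIsInvariantOfTwoDivisionField := by
  intro W W' _ _ _ _ hN hN' ht ht' hD hD' h2 h2' F _ _ hF hF' hQ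
  obtain ⟨Q, hQp, hQ2⟩ := hQ
  obtain ⟨k, hk⟩ := hfin F (Q ^ 2)
  rw [h W hN ht hD h2 F hF Q hQp hQ2 k hk, h W' hN' ht' hD' h2' F hF' Q hQp hQ2 k hk]

end Dictionary

section MarkedRealPlace
open NumberField

/-- Consistency: with `S = ∅` the archimedean character set is the finite one of §24.9. -/
theorem quadraticRayClassCharactersArch_empty (F : Type) [Field F] [NumberField F] (m : Ideal (𝓞 F)) :
    quadraticRayClassCharactersArch F m ∅ = quadraticRayClassCharacters F m := by
  ext χ
  simp only [quadraticRayClassCharactersArch, quadraticRayClassCharacters, Set.mem_setOf_eq, Set.mem_empty_iff_false,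
    false_implies, implies_true, forall_const]

end MarkedRealPlace

/-! ### REF1 §180 certificates (VERBATIM from `Probe180.lean`, ns `REF1g16e` → `ANg21`) -/
section Certificates
open NumberField

/-- The `Δ > 0` half of the dictionary is a COROLLARY of S38j (no Tate needed beyond S38j): `−N·q² < 0` and `Δ ≠ 0`. -/
theorem oddTamagawaPosDiscIffSameK_of_S38j (h : OddTamagawaIffDiscIsConductorTimesSquare) :
    OddTamagawaPosDiscIffSameK := by
  intro W _ _ hN
  constructor
  · rintro ⟨hodd, hpos⟩
    obtain ⟨q, hq0, hq | hq⟩ := (h W hN).mp hodd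
    · exact ⟨q, hq0, hq⟩
    · exfalso
      have hq2 : 0 < q ^ 2 := by positivity
      have hNn : (0 : ℚ) ≤ (W.conductorNorm ℤ : ℚ) := by exact_mod_cast Nat.zero_le _
      nlinarith [mul_nonneg hNn hq2.le]
  · rintro ⟨q, hq0, hq⟩
    refine ⟨(h W hN).mpr ⟨q, hq0, Or.inl hq⟩, ?_⟩
    have hΔ : W.Δ ≠ 0 := W.isUnit_Δ.ne_zero
    have hq2 : 0 < q ^ 2 := by positivity
    have hNn : (0 : ℚ) ≤ (W.conductorNorm ℤ : ℚ) := by exact_mod_cast Nat.zero_le _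
    rcases hNn.lt_or_eq with hNpos | hN0
    · rw [hq]; exact mul_pos hNpos hq2
    · exfalso; apply hΔ; rw [hq, ← hN0, zero_mul]

/-- S38k from the two ♮-laws and «`#Sel₂` is a power of two» (true: a finite `𝔽₂`-space; hypothesis `hpow` here), an
alternative to -an's `rootNumberInvariant_of_rootNumberLaw` whose `hfin` speaks about ray class characters. -/
theorem rootNumberInvariant_of_selmerLaws (hf : TwoSelmerIsCubicRayClassOddTamagawa)
    (hh : RootNumberFromCubicRayClassOddTamagawa)
    (hpow : ∀ (W : WeierstrassCurve ℚ) [W.IsElliptic], ∃ k : ℕ, Nat.card (W.selmerGroup 2) = 2 ^ k) :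
    RootNumberIsInvariantOfTwoDivisionField := by
  intro W W' _ _ _ _ hN hN' ht ht' hD hD' h2 h2' F _ _ hF hF' hQ
  obtain ⟨Q, hQp, hQ2⟩ := hQ
  obtain ⟨k, hk⟩ := hpow W
  have hchar : Nat.card (quadraticRayClassCharacters F (Q ^ 2)) = 2 ^ k := by
    rw [← hf W hN ht hD h2 F hF Q hQp hQ2, hk]
  rw [hh W hN ht hD h2 F hF Q hQp hQ2 k hchar, hh W' hN' ht' hD' h2' F hF' Q hQp hQ2 k hchar]

open scoped AddSubgroup in
/-- Glue (pattern of -an's `rootNumberLaw_of_selmerLaw`): S38l + 2-Selmer parity ⟹ S38m, for curves with `#E(ℚ)[2] = 1`. -/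
theorem rootNumberLawPos_of_selmerLawPos (hDD : even_selmerRank_sub_torsionRank_iff)
    (hS : TwoSelmerIsMarkedCubicRayClassPosDisc) :
    ∀ (W : WeierstrassCurve ℚ) [W.IsElliptic] [W.IsGloballyMinimal], Nat.card ((W.toAffine.Point)[(2 : ℤ)]) = 1 →
    Squarefree (W.conductorNorm ℤ) → Odd W.tamagawaProduct → 0 < W.Δ → NoRationalTwoTorsion W →
    ∀ (F : Type) [Field F] [NumberField F], IsCubicTwoDivisionField W F →
    ∀ Q : Ideal (𝓞 F), Q.IsPrime → (2 : 𝓞 F) ∈ Q ^ 2 →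
    ∀ (x₁ : F), (W.baseChange F).twoTorsionPolynomial.toPoly.IsRoot x₁ →
    ∀ (σ₁ σ₂ σ₃ : F →+* ℝ), σ₁ ≠ σ₂ → σ₁ ≠ σ₃ → σ₂ ≠ σ₃ → σ₁ x₁ < σ₂ x₁ → σ₁ x₁ < σ₃ x₁ →
    ∀ k : ℕ,
      2 * Nat.card (quadraticRayClassCharactersArch F (Q ^ 2) ∅)
        + Nat.card (quadraticRayClassCharactersArch F (Q ^ 2) {σ₂, σ₃})
      = 2 ^ k
        + Nat.card (quadraticRayClassCharactersArch F (Q ^ 2) {σ₂})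
        + Nat.card (quadraticRayClassCharactersArch F (Q ^ 2) {σ₃}) →
      W.rootNumber = (-1) ^ k := by
  intro W _ _ htors hN hc hΔ h2 F _ _ hF Q hQ hQ2 x₁ hx σ₁ σ₂ σ₃ h12 h13 h23 hl2 hl3 k hk
  have hS' := hS W hN hc hΔ h2 F hF Q hQ hQ2 x₁ hx σ₁ σ₂ σ₃ h12 h13 h23 hl2 hl3
  have hsel : Nat.card (W.selmerGroup 2) = 2 ^ k := by omega
  have ht : Nat.card ((W.toAffine.Point)[((2 : ℕ) : ℤ)]) = 2 ^ 0 := by simpa using htors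
  have hpar := hDD W 2 k 0 (by exact_mod_cast hsel) ht
  simp only [Nat.cast_zero, sub_zero, Int.even_coe_nat] at hpar
  rcases Nat.even_or_odd k with he | ho
  · rw [hpar.mp he, Even.neg_one_pow he]
  · have hne : W.rootNumber ≠ 1 := fun h1 => (Nat.not_even_iff_odd.mpr ho) (hpar.mpr h1)
    rcases WeierstrassCurve.rootNumber_eq_one_or W with h1 | h1
    · exact absurd h1 hne
    · rw [h1, Odd.neg_one_pow ho]

/-- A4 junk (as for the finite carrier): at the trivial modulus the archimedean character set is `{1}` whatever `S` is. -/
theorem quadraticRayClassCharactersArch_top (F : Type) [Field F] [NumberField F] (S : Set (F →+* ℝ)) :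
    quadraticRayClassCharactersArch F ⊤ S = {fun _ => 1} := by
  ext χ
  refine ⟨fun h => ?_, fun h => ?_⟩
  · obtain ⟨hmul, -, -⟩ := h
    funext J
    have h1 := hmul ⊥ J (by simp) (by simp)
    rw [Ideal.bot_mul] at h1
    have : χ J = 1 := by
      have h2 : χ ⊥ * χ J = χ ⊥ * 1 := by rw [mul_one]; exact h1.symm
      exact mul_left_cancel h2
    simpa using this
  · rw [Set.mem_singleton_iff] at h
    subst h
    refine ⟨?_, ?_, ?_⟩
    · intro I J _ _; simp
    · intro I _; rfl
    · intro a _ _ _; rfl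

/-- The S38l identity is symmetric in the two unmarked places (so the law does not depend on their order). -/
theorem markedCount_symm (F : Type) [Field F] [NumberField F] (m : Ideal (𝓞 F)) (σ₂ σ₃ : F →+* ℝ) (a s : ℕ) :
    (2 * a + Nat.card (quadraticRayClassCharactersArch F m {σ₂, σ₃})
      = s + Nat.card (quadraticRayClassCharactersArch F m {σ₂}) + Nat.card (quadraticRayClassCharactersArch F m {σ₃})) ↔
    (2 * a + Nat.card (quadraticRayClassCharactersArch F m {σ₃, σ₂})
      = s + Nat.card (quadraticRayClassCharactersArch F m {σ₃}) + Nat.card (quadraticRayClassCharactersArch F m {σ₂})) := by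
  rw [Set.pair_comm σ₃ σ₂]; constructor <;> intro h <;> omega

/-- REF1 §180 duty (1), support: `#Sel₂(E/ℚ)` is a power of `2` (a finite `𝔽₂`-space) — the tree's
`Literature.NumberTheory.EllipticCurves.exists_natCard_selmerGroup_eq_pow` at `p = 2`, with the cast `((2 : ℕ) : ℤ) = 2` performed; discharges the
`hpow` hypothesis of `rootNumberInvariant_of_selmerLaws`. -/
theorem exists_natCard_selmerGroup_two_eq_pow (W : WeierstrassCurve ℚ) [W.IsElliptic] :
    ∃ k : ℕ, Nat.card (W.selmerGroup 2) = 2 ^ k := by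
  obtain ⟨s, hs⟩ := exists_natCard_selmerGroup_eq_pow W 2
  exact ⟨s, by exact_mod_cast hs⟩

/-- S38k `RootNumberIsInvariantOfTwoDivisionField` from S38f♮ ∧ S38h♮ alone (REF1's certificate with `hpow` discharged). -/
theorem rootNumberIsInvariantOfTwoDivisionField_of_selmerLaws (hf : TwoSelmerIsCubicRayClassOddTamagawa)
    (hh : RootNumberFromCubicRayClassOddTamagawa) : RootNumberIsInvariantOfTwoDivisionField :=
  rootNumberInvariant_of_selmerLaws hf hh fun W _ => exists_natCard_selmerGroup_two_eq_pow W

end Certificates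

/-! ### REF1 §180 simplification glue: S38l ⟺ S38l′ and S38m ⟺ S38m′ modulo L180; S38m′ ⟸ S38l′ + parity (VERBATIM from `Probe180.lean`) -/
section Simplification
open NumberField

/-- Kernel glue: modulo (i), S38l ⟺ S38l′. -/
theorem marked_iff_coMarked (hi : SingleRealPlaceAddsNoCharacters) :
    TwoSelmerIsMarkedCubicRayClassPosDisc ↔ TwoSelmerIsCoMarkedRayClassPosDisc := by
  constructor
  · intro h W _ _ hN hc hΔ hT F _ _ hF Q hQ h2 x₁ hx σ₁ σ₂ σ₃ h12 h13 h23 hl2 hl3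
    have e := h W hN hc hΔ hT F hF Q hQ h2 x₁ hx σ₁ σ₂ σ₃ h12 h13 h23 hl2 hl3
    have e2 := hi F Q hQ h2 σ₂
    have e3 := hi F Q hQ h2 σ₃
    omega
  · intro h W _ _ hN hc hΔ hT F _ _ hF Q hQ h2 x₁ hx σ₁ σ₂ σ₃ h12 h13 h23 hl2 hl3
    have e := h W hN hc hΔ hT F hF Q hQ h2 x₁ hx σ₁ σ₂ σ₃ h12 h13 h23 hl2 hl3
    have e2 := hi F Q hQ h2 σ₂
    have e3 := hi F Q hQ h2 σ₃
    omega

/-- Kernel glue: modulo (i), S38m ⟺ S38m′. -/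
theorem markedRoot_iff_coMarkedRoot (hi : SingleRealPlaceAddsNoCharacters) :
    RootNumberFromMarkedCubicRayClassPosDisc ↔ RootNumberFromCoMarkedRayClassPosDisc := by
  constructor
  · intro h W _ _ hN hc hΔ hT F _ _ hF Q hQ h2 x₁ hx σ₁ σ₂ σ₃ h12 h13 h23 hl2 hl3 k hk
    have e2 := hi F Q hQ h2 σ₂
    have e3 := hi F Q hQ h2 σ₃
    exact h W hN hc hΔ hT F hF Q hQ h2 x₁ hx σ₁ σ₂ σ₃ h12 h13 h23 hl2 hl3 k (by omega)
  · intro h W _ _ hN hc hΔ hT F _ _ hF Q hQ h2 x₁ hx σ₁ σ₂ σ₃ h12 h13 h23 hl2 hl3 k hk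
    have e2 := hi F Q hQ h2 σ₂
    have e3 := hi F Q hQ h2 σ₃
    exact h W hN hc hΔ hT F hF Q hQ h2 x₁ hx σ₁ σ₂ σ₃ h12 h13 h23 hl2 hl3 k (by omega)

open scoped AddSubgroup in
/-- S38l′ + 2-Selmer parity ⟹ S38m′ (for curves with `#E(ℚ)[2] = 1`), exactly as `rootNumberLawPos_of_selmerLawPos`. -/
theorem coMarkedRoot_of_coMarked (hDD : even_selmerRank_sub_torsionRank_iff) (hS : TwoSelmerIsCoMarkedRayClassPosDisc) :
    ∀ (W : WeierstrassCurve ℚ) [W.IsElliptic] [W.IsGloballyMinimal],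
    Squarefree (W.conductorNorm ℤ) → Odd W.tamagawaProduct → 0 < W.Δ → NoRationalTwoTorsion W →
    Nat.card ((W.toAffine.Point)[(2 : ℤ)]) = 1 →
    ∀ (F : Type) [Field F] [NumberField F], IsCubicTwoDivisionField W F →
    ∀ Q : Ideal (𝓞 F), Q.IsPrime → (2 : 𝓞 F) ∈ Q ^ 2 →
    ∀ (x₁ : F), (W.baseChange F).twoTorsionPolynomial.toPoly.IsRoot x₁ →
    ∀ (σ₁ σ₂ σ₃ : F →+* ℝ), σ₁ ≠ σ₂ → σ₁ ≠ σ₃ → σ₂ ≠ σ₃ → σ₁ x₁ < σ₂ x₁ → σ₁ x₁ < σ₃ x₁ →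
    ∀ k : ℕ, Nat.card (quadraticRayClassCharactersArch F (Q ^ 2) {σ₂, σ₃}) = 2 ^ k → W.rootNumber = (-1) ^ k := by
  intro W _ _ hN hc hΔ hT htors F _ _ hF Q hQ h2 x₁ hx σ₁ σ₂ σ₃ h12 h13 h23 hl2 hl3 k hk
  have hsel := hS W hN hc hΔ hT F hF Q hQ h2 x₁ hx σ₁ σ₂ σ₃ h12 h13 h23 hl2 hl3
  rw [hk] at hsel
  have ht : Nat.card ((W.toAffine.Point)[((2 : ℕ) : ℤ)]) = 2 ^ 0 := by simpa using htors
  have hpar := hDD W 2 k 0 (by exact_mod_cast hsel) ht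
  simp only [Nat.cast_zero, sub_zero, Int.even_coe_nat] at hpar
  rcases Nat.even_or_odd k with he | ho
  · rw [hpar.mp he, Even.neg_one_pow he]
  · have hne : W.rootNumber ≠ 1 := fun h1 => (Nat.not_even_iff_odd.mpr ho) (hpar.mpr h1)
    rcases WeierstrassCurve.rootNumber_eq_one_or W with h1 | h1
    · exact absurd h1 hne
    · rw [h1, Odd.neg_one_pow ho]

end Simplification

section GrandUnified
open NumberField

/-- The decider is a formal consequence of the law. -/
theorem shaTwoDecider_of_grandUnifiedLaw (h : TwoSelmerIsMarkedTwoDivisionFieldNegDisc) : ShaTwoTrivialIffMarkedCountTwoNegDisc := by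
  intro W _ _ hN ht h2 hD _ F _ _ hF x₁ hx θ hθ
  rw [h W hN ht h2 hD F hF x₁ hx θ hθ]

/-- A2 (REF1 §180): S38q as TYPED is S38n rewritten — the `analyticRank = 1` hypothesis is decoration and no GZK input is used;
the decider CONTENT («`Ш[2] = 0 ⟺ #M(∅) = 2` at analytic rank 1») lives only in the docstring.  Same statement without the hypothesis: -/
theorem shaTwoDecider_without_analyticRank (h : TwoSelmerIsMarkedTwoDivisionFieldNegDisc) :
    ∀ (W : WeierstrassCurve ℚ) [W.IsElliptic] [W.IsGloballyMinimal],
    Squarefree (W.conductorNorm ℤ) → Odd W.tamagawaProduct → NoRationalTwoTorsion W → W.Δ < 0 →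
    ∀ (F : Type) [Field F] [NumberField F], IsCubicTwoDivisionField W F →
    ∀ (x₁ : F), (W.baseChange F).twoTorsionPolynomial.toPoly.IsRoot x₁ → ∀ (θ : 𝓞 F), (θ : F) = 4 * x₁ →
      (Nat.card (W.selmerGroup 2) = 2 ↔ Nat.card (markedQuadraticCharacters F θ ∅) = 2) := by
  intro W _ _ hN ht h2 hD F _ _ hF x₁ hx θ hθ
  rw [h W hN ht h2 hD F hF x₁ hx θ hθ]

end GrandUnified

end Summit.BirchSwinnertonDyer.Rank1Residual.F1Sign2.ANg21
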